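import Literature.MathematicalPhysics.QuantumFieldTheory.Balaban1983to89.B12Eq311RemainderBound

/-!
# `Balaban1983to89.B12Eq311RemainderQuadratic` — T. Bałaban, *Renormalization group approach to lattice gauge field theories. I*,
Commun. Math. Phys. **109** (1987) 249–301 [Balaban1987RG1], §3 p. 279: «the formulas and the bounds (1.43)–(1.54) [14] … for the
second order operator ∂^{ξ*}∂^ξ» — **the remainder `𝐅(U, 𝐀)` of (3.11) on a FLAT background is QUADRATIC in the size of `𝐀`, and (3.11)
at the trivial background for the concrete current (1.8): `J(exp iξ𝐊) = ∂^{ξ*}π∂^ξ𝐊 + 𝐅(1, 𝐊)`** (file 1 of 2 of p07 gen 8; file 2 =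
`B12CondIIIJConcrete`, the J-half of condition (iii) for the Lemma-4 configuration).

HONEST FRAMING (cell `lit-balaban`, verbatim): statement-level skeleton of published theorems with citation tags; proofs where landed; nothing here is a claim about the Yang–Mills mass gap.

PDF held: `paper:balaban1987-cmp109-rg-i-small-field` (journal page = PDF page + 248); p. 279 re-read as image from the render
`b2b-balaban-ref1/pages/1987-cmp109-rg-I-small-field/1987-cmp109-rg-I-small-field-p031-x4.png` by this unit.  THE PRINT, verbatim
(p. 279, after (3.47)): *«The second inequality in this condition is obtained in the same way. We start with (3.42) and we use again
the formulas and the bounds (1.43)–(1.54) [14]. They give a bound of the type (3.44), but for the second order operator ∂^{ξ*}∂^ξ.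
Then the same reasoning as between (3.44)–(3.47) gives the required second inequality in (iii).»* ([14] = [Balaban1985RegularSpaces],
(1.43)–(1.54) pp. 83–85 = the expansion behind (3.11) p. 272, kernel-checked in general form by p07 gen 7:
`B12Eq311CurrentExpansion.eq311` / `B12Eq311RemainderBound.norm_F311_le`.)

WHAT THIS MODULE PROVES (theorems only; no `def`, no new `Prop`, no new fact; axioms standard).
§1 `termI_sq_le`, `termQ_sq_le`, `termR_sq_le`, **`norm_F311_le_sq`**: the three terms of `norm_F311_le` with `a = g = s`, `ε = 0`
   (flat background: `U(∂p) = 1` on the positively oriented plaquettes, `‖U(b)^{±1}‖ ≤ ρ`, `1 ≤ ρ`) are `≤ Cπ·K(ρ)·s²` for the SAME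
   gen-7 constants `KI`, `KQ`, `KR` (`0 < ξ ≤ 1`, `0 ≤ s ≤ 1`), hence `‖𝐅(U, 𝐀)(b)‖ ≤ (d − 1)·Cπ·C_F(ρ)·s²`, `C_F = C311`: the SHAPE
   (J1) «C·α₀²·x²» of `B12CondIIIJ` (quadratic in the common bound of `|𝐀|` and `|∇^ξ_U𝐀|`, no further lattice factor).
§2 the torus at `U = 1`: `expI_eq_sub310_one`, **`current_expI_eq`** (`J(exp iξ𝐊)(b) = (∂^{ξ*}π∂^ξ𝐊)(b) + 𝐅(1, 𝐊)(b)`, from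
   `B12Eq311CurrentExpansion.eq311_current` and `B12Eq338CondIV.current_one`), `lapCur_add/_smul/_sub` (the second-order operator
   `D^{ξ*}_U π D^ξ_U` = `B12Eq311CurrentExpansion.lapCur` is linear in the field, via `B9Eq310Hermitian.curlη_add/…/divPη_smul` BY NAME),
   **`norm_rem311_one_le_sq`** (`‖𝐅(1, 𝐊)(b)‖ ≤ (d − 1)·Cπ·C_F(1)·s²` for `|𝐊|, |∇^ξ𝐊| ≤ s`; `[NormOneClass 𝔸]` supplies `‖1‖ = 1`,
   as the operator-norm models `B12RegularSpaces111Unitary/SpecialUnitary` do).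
HONEST SCOPE. (a) Sizes on ALL bonds / sites of the finite periodic lattice (locality is `B12Eq311Locality.rem311_congr`). (b) Constants ours
([14] prints `10d, 36d, 50d` for `ρ = 1`, `π = id`). (c) Nothing here bears on Theorem 2 or the continuum limit.
Unit `lit-balaban-p07` (Phase-2 seat p07 gen 8; TAKING line HOME/STATUS.md 2026-08-21T18:46:03Z; rows B12.Lem4 / B12.Eq3.36 /
B12.Eq3.37-3.47, owners r09/r20), HOME `run/shared/lean/pub/lit-balaban/`.
-/


noncomputable section

open NormedSpace Complex

namespace Literature.MathematicalPhysics.QuantumFieldTheory.Balaban1983to89.B12Eq311RemainderQuadratic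

open Literature.MathematicalPhysics.QuantumFieldTheory.Balaban1983to89
open Literature.MathematicalPhysics.QuantumFieldTheory.Balaban1983to89.B9Eq39Adjoint
open Literature.MathematicalPhysics.QuantumFieldTheory.Balaban1983to89.B9TorusCalculus
open Literature.MathematicalPhysics.QuantumFieldTheory.Balaban1983to89.B12Eq311CurrentExpansion
open Literature.MathematicalPhysics.QuantumFieldTheory.Balaban1983to89.B12Eq311RemainderBound
open Literature.MathematicalPhysics.QuantumFieldTheory.Balaban1983to89.B12RegularSpaces111
open Literature.MathematicalPhysics.QuantumFieldTheory.Balaban1983to89.B12Eq18Current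

/-! ## §1  «The formulas and the bounds (1.43)–(1.54) [14]» for the second-order operator: the remainder of (3.11) on a flat
background is QUADRATIC in the size of `𝐀` -/

section Quadratic

variable {ρ ξ Cπ s : ℝ}

/-- `e^x − 1 ≤ x·e^x`. [folklore] -/
private theorem exp_sub_one_le_mul_exp (x : ℝ) : Real.exp x - 1 ≤ x * Real.exp x := by
  have h := Real.add_one_le_exp (-x)
  have hx' : Real.exp (-x) * Real.exp x = 1 := by rw [← Real.exp_add, neg_add_cancel, Real.exp_zero]
  nlinarith [Real.exp_pos x, Real.exp_pos (-x)]

/-- TERM I of `norm_F311_le` on a flat background (`ε = 0`) with `a = g = s ≤ 1`: `≤ Cπ·K_I(ρ)·s²`.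
[cite: Balaban1985RegularSpaces, (1.54) p.85] -/
theorem termI_sq_le (hξ : 0 < ξ) (hξ1 : ξ ≤ 1) (hρ : 1 ≤ ρ) (hs : 0 ≤ s) (hs1 : s ≤ 1) (hCπ : 0 ≤ Cπ) :
    ξ⁻¹ * ((Real.exp (2 * (ξ * (ρ ^ 2 * s))) - 1) * (ρ ^ 2 *
        (Cπ * ((1 + (Real.exp (ξ * s) * ρ) ^ 4) / 2
          * (2 * s + 1 / 2 * (2 * (1 + ρ ^ 2) * s) ^ 2 * Real.exp (ξ * (2 * (1 + ρ ^ 2) * s))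
            + Real.exp (ξ * (2 * (1 + ρ ^ 2) * s)) * (0 / ξ ^ 2))))))
      ≤ Cπ * KI ρ * s ^ 2 := by
  have hρ0 : 0 ≤ ρ := by linarith
  have hS₀0 : 0 ≤ 2 * (1 + ρ ^ 2) := by positivity
  have hξs1 : ξ * s ≤ 1 := by nlinarith
  have hsb0 : 0 ≤ 2 * (1 + ρ ^ 2) * s := mul_nonneg hS₀0 hs
  have hξs : ξ * (2 * (1 + ρ ^ 2) * s) ≤ 2 * (1 + ρ ^ 2) := by nlinarith
  have hE1 : Real.exp (ξ * (2 * (1 + ρ ^ 2) * s)) ≤ Real.exp (2 * (1 + ρ ^ 2)) := Real.exp_le_exp.mpr hξs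
  have hE0 := Real.exp_pos (ξ * (2 * (1 + ρ ^ 2) * s))
  have t1a : ξ⁻¹ * (Real.exp (2 * (ξ * (ρ ^ 2 * s))) - 1) ≤ 2 * ρ ^ 2 * s * Real.exp (2 * ρ ^ 2) := by
    have h1 := exp_sub_one_le_mul_exp (2 * (ξ * (ρ ^ 2 * s)))
    have h2 : Real.exp (2 * (ξ * (ρ ^ 2 * s))) ≤ Real.exp (2 * ρ ^ 2) := by
      refine Real.exp_le_exp.mpr ?_
      calc 2 * (ξ * (ρ ^ 2 * s)) = 2 * ρ ^ 2 * (ξ * s) := by ring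
        _ ≤ 2 * ρ ^ 2 * 1 := mul_le_mul_of_nonneg_left hξs1 (by positivity)
        _ = 2 * ρ ^ 2 := by ring
    calc ξ⁻¹ * (Real.exp (2 * (ξ * (ρ ^ 2 * s))) - 1) ≤ ξ⁻¹ * (2 * (ξ * (ρ ^ 2 * s)) * Real.exp (2 * (ξ * (ρ ^ 2 * s)))) :=
          mul_le_mul_of_nonneg_left h1 (inv_nonneg.mpr hξ.le)
      _ = 2 * ρ ^ 2 * s * Real.exp (2 * (ξ * (ρ ^ 2 * s))) := by field_simp
      _ ≤ 2 * ρ ^ 2 * s * Real.exp (2 * ρ ^ 2) := mul_le_mul_of_nonneg_left h2 (by positivity)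
  have t1b : (1 + (Real.exp (ξ * s) * ρ) ^ 4) / 2 ≤ (1 + Real.exp 4 * ρ ^ 4) / 2 := by
    have e4 : (Real.exp (ξ * s) * ρ) ^ 4 = Real.exp (4 * (ξ * s)) * ρ ^ 4 := by
      rw [mul_pow, ← Real.exp_nat_mul]; norm_num
    rw [e4]
    have : Real.exp (4 * (ξ * s)) ≤ Real.exp 4 := Real.exp_le_exp.mpr (by linarith)
    have : Real.exp (4 * (ξ * s)) * ρ ^ 4 ≤ Real.exp 4 * ρ ^ 4 := mul_le_mul_of_nonneg_right this (pow_nonneg hρ0 4)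
    linarith
  have t1c : 2 * s + 1 / 2 * (2 * (1 + ρ ^ 2) * s) ^ 2 * Real.exp (ξ * (2 * (1 + ρ ^ 2) * s))
        + Real.exp (ξ * (2 * (1 + ρ ^ 2) * s)) * (0 / ξ ^ 2)
      ≤ s * (2 + 1 / 2 * (2 * (1 + ρ ^ 2)) ^ 2 * Real.exp (2 * (1 + ρ ^ 2)) + Real.exp (2 * (1 + ρ ^ 2))) := by
    rw [zero_div, mul_zero, add_zero]
    have hss : s ^ 2 ≤ s := by nlinarith
    have h2 : 1 / 2 * (2 * (1 + ρ ^ 2) * s) ^ 2 * Real.exp (ξ * (2 * (1 + ρ ^ 2) * s))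
        ≤ s * (1 / 2 * (2 * (1 + ρ ^ 2)) ^ 2 * Real.exp (2 * (1 + ρ ^ 2))) := by
      calc 1 / 2 * (2 * (1 + ρ ^ 2) * s) ^ 2 * Real.exp (ξ * (2 * (1 + ρ ^ 2) * s))
          = s ^ 2 * (1 / 2 * (2 * (1 + ρ ^ 2)) ^ 2 * Real.exp (ξ * (2 * (1 + ρ ^ 2) * s))) := by ring
        _ ≤ s * (1 / 2 * (2 * (1 + ρ ^ 2)) ^ 2 * Real.exp (2 * (1 + ρ ^ 2))) :=
            mul_le_mul hss (mul_le_mul_of_nonneg_left hE1 (by positivity)) (by positivity) hs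
    have h3 : 0 ≤ s * Real.exp (2 * (1 + ρ ^ 2)) := by positivity
    nlinarith
  have hP1 : 0 ≤ 2 * s + 1 / 2 * (2 * (1 + ρ ^ 2) * s) ^ 2 * Real.exp (ξ * (2 * (1 + ρ ^ 2) * s))
      + Real.exp (ξ * (2 * (1 + ρ ^ 2) * s)) * (0 / ξ ^ 2) := by positivity
  have hr1 : 0 ≤ (1 + (Real.exp (ξ * s) * ρ) ^ 4) / 2 := by positivity
  have ht1a0 : 0 ≤ ξ⁻¹ * (Real.exp (2 * (ξ * (ρ ^ 2 * s))) - 1) :=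
    mul_nonneg (inv_nonneg.mpr hξ.le) (by nlinarith [Real.one_le_exp (show 0 ≤ 2 * (ξ * (ρ ^ 2 * s)) by positivity)])
  calc ξ⁻¹ * ((Real.exp (2 * (ξ * (ρ ^ 2 * s))) - 1) * (ρ ^ 2 *
        (Cπ * ((1 + (Real.exp (ξ * s) * ρ) ^ 4) / 2
          * (2 * s + 1 / 2 * (2 * (1 + ρ ^ 2) * s) ^ 2 * Real.exp (ξ * (2 * (1 + ρ ^ 2) * s))
            + Real.exp (ξ * (2 * (1 + ρ ^ 2) * s)) * (0 / ξ ^ 2))))))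
      = (ξ⁻¹ * (Real.exp (2 * (ξ * (ρ ^ 2 * s))) - 1)) * ρ ^ 2 * Cπ *
          (((1 + (Real.exp (ξ * s) * ρ) ^ 4) / 2)
            * (2 * s + 1 / 2 * (2 * (1 + ρ ^ 2) * s) ^ 2 * Real.exp (ξ * (2 * (1 + ρ ^ 2) * s))
              + Real.exp (ξ * (2 * (1 + ρ ^ 2) * s)) * (0 / ξ ^ 2))) := by ring
    _ ≤ (2 * ρ ^ 2 * s * Real.exp (2 * ρ ^ 2)) * ρ ^ 2 * Cπ *
          (((1 + Real.exp 4 * ρ ^ 4) / 2)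
            * (s * (2 + 1 / 2 * (2 * (1 + ρ ^ 2)) ^ 2 * Real.exp (2 * (1 + ρ ^ 2)) + Real.exp (2 * (1 + ρ ^ 2))))) := by
        refine mul_le_mul (mul_le_mul_of_nonneg_right (mul_le_mul_of_nonneg_right t1a (sq_nonneg ρ)) hCπ)
          (mul_le_mul t1b t1c hP1 (by positivity)) (mul_nonneg hr1 hP1) (by positivity)
    _ = Cπ * KI ρ * s ^ 2 := by rw [KI]; ring

/-- TERM q of `norm_F311_le` with `a = g = s`: `= Cπ·K_q(ρ)·s²` ([14] (1.53)). [cite: Balaban1985RegularSpaces, (1.53) p.85] -/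
theorem termQ_sq_le (hξ : 0 < ξ) :
    (ξ ^ 3)⁻¹ * (Cπ * (ξ ^ 3 * ((1 + ρ ^ 2) * (3 * ρ ^ 2 + 1) * (2 * (1 + ρ ^ 2) * s) * s)))
      ≤ Cπ * KQ ρ * s ^ 2 := by
  have e : (ξ ^ 3)⁻¹ * (Cπ * (ξ ^ 3 * ((1 + ρ ^ 2) * (3 * ρ ^ 2 + 1) * (2 * (1 + ρ ^ 2) * s) * s)))
      = Cπ * (2 * (1 + ρ ^ 2) ^ 2 * (3 * ρ ^ 2 + 1)) * s ^ 2 := by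
    field_simp
  rw [e, KQ]

/-- TERM r of `norm_F311_le` on a flat background (`ε = 0`) with `a = s ≤ 1`: `≤ Cπ·K_r(ρ)·s²` ([14] (1.48)).
[cite: Balaban1985RegularSpaces, (1.54) p.85] -/
theorem termR_sq_le (hξ : 0 < ξ) (hξ1 : ξ ≤ 1) (hρ : 1 ≤ ρ) (hs : 0 ≤ s) (hs1 : s ≤ 1) (hCπ : 0 ≤ Cπ) :
    (ξ ^ 3)⁻¹ * ((ρ ^ 2 + 1) * (Cπ * ((ξ * (2 * (1 + ρ ^ 2) * s)) ^ 3 / 6 * Real.exp (ξ * (2 * (1 + ρ ^ 2) * s))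
        + (Real.exp (ξ * (2 * (1 + ρ ^ 2) * s)) - 1) * Real.exp (ξ * (2 * (1 + ρ ^ 2) * s)) * (1 + ρ ^ 4) * 0)))
      ≤ Cπ * KR ρ * s ^ 2 := by
  have hρ0 : 0 ≤ ρ := by linarith
  have hS₀0 : 0 ≤ 2 * (1 + ρ ^ 2) := by positivity
  have hsb0 : 0 ≤ 2 * (1 + ρ ^ 2) * s := mul_nonneg hS₀0 hs
  have hξs : ξ * (2 * (1 + ρ ^ 2) * s) ≤ 2 * (1 + ρ ^ 2) := by nlinarith
  have hE1 : Real.exp (ξ * (2 * (1 + ρ ^ 2) * s)) ≤ Real.exp (2 * (1 + ρ ^ 2)) := Real.exp_le_exp.mpr hξs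
  have hE0 := Real.exp_pos (ξ * (2 * (1 + ρ ^ 2) * s))
  have hs3 : s ^ 3 ≤ s ^ 2 := by nlinarith
  have t3a : (ξ * (2 * (1 + ρ ^ 2) * s)) ^ 3 / 6 * Real.exp (ξ * (2 * (1 + ρ ^ 2) * s))
      ≤ ξ ^ 3 * ((2 * (1 + ρ ^ 2)) ^ 3 / 6 * Real.exp (2 * (1 + ρ ^ 2)) * s ^ 2) := by
    calc (ξ * (2 * (1 + ρ ^ 2) * s)) ^ 3 / 6 * Real.exp (ξ * (2 * (1 + ρ ^ 2) * s))
        = ξ ^ 3 * ((2 * (1 + ρ ^ 2)) ^ 3 / 6 * Real.exp (ξ * (2 * (1 + ρ ^ 2) * s)) * s ^ 3) := by ring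
      _ ≤ ξ ^ 3 * ((2 * (1 + ρ ^ 2)) ^ 3 / 6 * Real.exp (2 * (1 + ρ ^ 2)) * s ^ 2) := by
          refine mul_le_mul_of_nonneg_left ?_ (pow_nonneg hξ.le 3)
          exact mul_le_mul (mul_le_mul_of_nonneg_left hE1 (by positivity)) hs3 (by positivity) (by positivity)
  rw [mul_zero, add_zero]
  calc (ξ ^ 3)⁻¹ * ((ρ ^ 2 + 1) * (Cπ * ((ξ * (2 * (1 + ρ ^ 2) * s)) ^ 3 / 6 * Real.exp (ξ * (2 * (1 + ρ ^ 2) * s)))))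
      ≤ (ξ ^ 3)⁻¹ * ((ρ ^ 2 + 1) * (Cπ * (ξ ^ 3 * ((2 * (1 + ρ ^ 2)) ^ 3 / 6 * Real.exp (2 * (1 + ρ ^ 2)) * s ^ 2)))) := by
        refine mul_le_mul_of_nonneg_left (mul_le_mul_of_nonneg_left (mul_le_mul_of_nonneg_left t3a hCπ) (by positivity))
          (inv_nonneg.mpr (pow_nonneg hξ.le 3))
    _ = Cπ * (2 * (1 + ρ ^ 2) ^ 2 * ((2 * (1 + ρ ^ 2)) ^ 2 / 6 * Real.exp (2 * (1 + ρ ^ 2)))) * s ^ 2 := by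
        field_simp
        ring
    _ ≤ Cπ * KR ρ * s ^ 2 := by
        rw [KR]
        refine mul_le_mul_of_nonneg_right (mul_le_mul_of_nonneg_left ?_ hCπ) (sq_nonneg s)
        have : 0 ≤ 2 * (1 + ρ ^ 2) ^ 2 * (Real.exp (2 * (2 * (1 + ρ ^ 2))) * (1 + ρ ^ 4)) := by positivity
        nlinarith

variable {𝔸 : Type*} [NormedRing 𝔸] [NormedAlgebra ℂ 𝔸] [CompleteSpace 𝔸] {S : Type*} {ι : Type*} [Fintype ι] [LinearOrder ι]
variable (T : ι → Equiv.Perm S) (U : ι → S → 𝔸ˣ) {A : ι → S → 𝔸} {π : 𝔸 →ₗ[ℂ] 𝔸}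

/-- **«The formulas and the bounds (1.43)–(1.54) [14]» for the second order operator — the remainder `𝐅(U, 𝐀)` of (3.11) on a FLAT
background is quadratic**: for `0 < ξ ≤ 1`, bond variables with `‖U(b)^{±1}‖ ≤ ρ` (`1 ≤ ρ`) and `U(∂p) = 1` on the positively oriented
plaquettes, `|𝐀| ≤ s`, `‖D¹_U𝐀‖ ≤ ξs` (`|∇^ξ_U𝐀| ≤ s`), `0 ≤ s ≤ 1`, and `π` with `‖πX‖ ≤ Cπ‖X‖` commuting with the transports:
`‖𝐅(U, 𝐀)(b)‖ ≤ (d − 1)·Cπ·C_F(ρ)·s²` — the (J1)-SHAPE of `B12CondIIIJ` (quadratic in the common size of the field and its gradient).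
[cite: Balaban1987RG1, p.279 after (3.47)] -/
theorem norm_F311_le_sq (hξ : 0 < ξ) (hξ1 : ξ ≤ 1) (hρ : 1 ≤ ρ)
    (hU : ∀ μ x, ‖(U μ x : 𝔸)‖ ≤ ρ ∧ ‖(((U μ x)⁻¹ : 𝔸ˣ) : 𝔸)‖ ≤ ρ)
    (hs : 0 ≤ s) (hs1 : s ≤ 1) (hA : ∀ μ x, ‖A μ x‖ ≤ s) (hDA : ∀ κ ν y, ‖covD T U κ (A ν) y‖ ≤ ξ * s)
    (hflat : ∀ κ ν, κ < ν → ∀ y, plaqU T U κ ν y = 1) (hCπ : 0 ≤ Cπ)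
    (hπn : ∀ X, ‖π X‖ ≤ Cπ * ‖X‖) (hπR : ∀ μ x X, π (R (U μ x)⁻¹ X) = R (U μ x)⁻¹ (π X)) (μ : ι) (x : S) :
    ‖F311 T π ξ U A μ x‖ ≤ (Fintype.card ι - 1) * (Cπ * C311 ρ * s ^ 2) := by
  have hP : ∀ κ ν, κ < ν → ∀ y, ‖(plaqU T U κ ν y : 𝔸) - 1‖ ≤ 0 := fun κ ν hκν y => by
    rw [hflat κ ν hκν y, Units.val_one, sub_self, norm_zero]
  have main := norm_F311_le T U hξ hU hA hDA hP hCπ hπn hπR μ x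
  refine main.trans (mul_le_mul_of_nonneg_left ?_ ?_)
  · rw [mul_add (ξ ^ 3)⁻¹, C311,
      show Cπ * (KI ρ + KQ ρ + KR ρ) * s ^ 2 = Cπ * KI ρ * s ^ 2 + (Cπ * KQ ρ * s ^ 2 + Cπ * KR ρ * s ^ 2) by ring]
    exact add_le_add (termI_sq_le hξ hξ1 hρ hs hs1 hCπ)
      (add_le_add (termQ_sq_le (ρ := ρ) (Cπ := Cπ) (s := s) hξ) (termR_sq_le hξ hξ1 hρ hs hs1 hCπ))
  · have : (1 : ℝ) ≤ Fintype.card ι := by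
      have : 0 < Fintype.card ι := Fintype.card_pos_iff.mpr ⟨μ⟩
      exact_mod_cast this
    linarith

end Quadratic

/-! ## §2  The torus at the trivial background `U = 1`: (3.11) for `exp iξ𝐊`, linearity of `∂^{ξ*}π∂^ξ`, the quadratic bound -/

section TorusOne

variable {P : Params} {i : ℕ} {𝔸 : Type*} [NormedRing 𝔸] [NormedAlgebra ℂ 𝔸] [CompleteSpace 𝔸]

/-- `exp iξ𝐊` is the substitution (3.10) at the trivial background: `exp iξ𝐊 = exp iξ𝐊·1` (`B12Eq311CurrentExpansion.sub310`).
[cite: Balaban1987RG1, (3.10) p.272] -/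
theorem expI_eq_sub310_one (ξ : ℝ) (K : PBond P i → 𝔸) :
    (fun b => expI ξ (K b)) = sub310 ξ K (1 : PBond P i → 𝔸ˣ) := by
  funext b
  rw [sub310_eq_expI_mul, Pi.one_apply, mul_one]

/-- **(3.11) at `U = 1` for the concrete current (1.8)**: `J(exp iξ𝐊)(b) = (∂^{ξ*}π∂^ξ𝐊)(b) + 𝐅(1, 𝐊)(b)` — `J(1) = 0`
(`B12Eq338CondIV.current_one`), the first-order term is the second-order operator `D^{ξ*}_1 π D^ξ_1 = ∂^{ξ*}π∂^ξ` of p. 279.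
[cite: Balaban1987RG1, (3.11) p.272] -/
theorem current_expI_eq (π : 𝔸 →ₗ[ℂ] 𝔸) (ξ : ℝ) (K : PBond P i → 𝔸) (b : PBond P i) :
    current π ξ (fun b => expI ξ (K b)) b
      = lapCur π ξ (1 : PBond P i → 𝔸ˣ) K b + rem311 π ξ (1 : PBond P i → 𝔸ˣ) K b := by
  rw [expI_eq_sub310_one, eq311_current, B12Eq338CondIV.current_one, Pi.zero_apply, zero_add]

omit [CompleteSpace 𝔸] in
/-- The second-order operator `D^{ξ*}_U π D^ξ_U` of (3.11) (`∂^{ξ*}π∂^ξ` at `U = 1`) is additive in the field.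
[cite: Balaban1987RG1, (3.11) p.272] -/
theorem lapCur_add (π : 𝔸 →ₗ[ℂ] 𝔸) (ξ : ℝ) (U : PBond P i → 𝔸ˣ) (A B : PBond P i → 𝔸) (b : PBond P i) :
    lapCur π ξ U (A + B) b = lapCur π ξ U A b + lapCur π ξ U B b := by
  simp only [lapCur, lapπ]
  have h : (fun μ ν x => π (curlη (torusT P i) (dirForm U) ξ (dirForm (A + B)) μ ν x))
      = (fun μ ν x => π (curlη (torusT P i) (dirForm U) ξ (dirForm A) μ ν x))
        + (fun μ ν x => π (curlη (torusT P i) (dirForm U) ξ (dirForm B) μ ν x)) := by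
    have hAB : dirForm (A + B) = dirForm A + dirForm B := rfl
    funext μ ν x
    rw [hAB, B9Eq310Hermitian.curlη_add]
    simp only [Pi.add_apply, map_add]
  rw [h, B9Eq310Hermitian.divPη_add]

omit [CompleteSpace 𝔸] in
/-- The second-order operator `D^{ξ*}_U π D^ξ_U` of (3.11) is homogeneous in the field. [cite: Balaban1987RG1, (3.11) p.272] -/
theorem lapCur_smul (π : 𝔸 →ₗ[ℂ] 𝔸) (ξ : ℝ) (U : PBond P i → 𝔸ˣ) (c : ℂ) (A : PBond P i → 𝔸) (b : PBond P i) :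
    lapCur π ξ U (c • A) b = c • lapCur π ξ U A b := by
  simp only [lapCur, lapπ]
  have h : (fun μ ν x => π (curlη (torusT P i) (dirForm U) ξ (dirForm (c • A)) μ ν x))
      = c • (fun μ ν x => π (curlη (torusT P i) (dirForm U) ξ (dirForm A) μ ν x)) := by
    have hcA : dirForm (c • A) = c • dirForm A := rfl
    funext μ ν x
    rw [hcA, B9Eq310Hermitian.curlη_smul]
    simp only [Pi.smul_apply, map_smul]
  rw [h, B9Eq310Hermitian.divPη_smul]

omit [CompleteSpace 𝔸] in
/-- The second-order operator `D^{ξ*}_U π D^ξ_U` of (3.11) respects subtraction. [cite: Balaban1987RG1, (3.11) p.272] -/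
theorem lapCur_sub (π : 𝔸 →ₗ[ℂ] 𝔸) (ξ : ℝ) (U : PBond P i → 𝔸ˣ) (A B : PBond P i → 𝔸) (b : PBond P i) :
    lapCur π ξ U (A - B) b = lapCur π ξ U A b - lapCur π ξ U B b := by
  rw [sub_eq_add_neg, lapCur_add, ← neg_one_smul ℂ B, lapCur_smul, neg_one_smul, ← sub_eq_add_neg]

variable [NormOneClass 𝔸]

/-- **‖𝐅(1, 𝐊)(b)‖ ≤ (d − 1)·Cπ·C_F(1)·s²** — the quadratic remainder bound of §1 on the torus at the trivial background, in the
letters of the spaces (1.11)–(1.14): `0 < ξ ≤ 1`, `|𝐊| ≤ s`, `|∇^ξ𝐊| ≤ s` (plain gradient `B12RegularSpaces111.grad` of every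
component in every direction), `0 ≤ s ≤ 1`, `‖πX‖ ≤ Cπ‖X‖`. [cite: Balaban1987RG1, p.279 after (3.47)] -/
theorem norm_rem311_one_le_sq {ξ Cπ s : ℝ} {π : 𝔸 →ₗ[ℂ] 𝔸} {K : PBond P i → 𝔸}
    (hξ : 0 < ξ) (hξ1 : ξ ≤ 1) (hs : 0 ≤ s) (hs1 : s ≤ 1) (hK : ∀ b, ‖K b‖ ≤ s)
    (hDK : ∀ μ ν x, ‖grad ξ μ (fun y => K ⟨y, ν⟩) x‖ ≤ s) (hCπ : 0 ≤ Cπ) (hπn : ∀ X, ‖π X‖ ≤ Cπ * ‖X‖) (b : PBond P i) :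
    ‖rem311 π ξ (1 : PBond P i → 𝔸ˣ) K b‖ ≤ (P.d - 1) * (Cπ * C311 1 * s ^ 2) := by
  have h := norm_F311_le_sq (torusT P i) (dirForm (1 : PBond P i → 𝔸ˣ)) (A := dirForm K) (π := π) (ρ := 1)
    hξ hξ1 le_rfl (fun μ x => by simp [dirForm]) hs hs1 (fun μ x => hK ⟨x, μ⟩)
    (fun κ ν y => (B9Eq369Product.norm_eta_inv_smul_le_iff hξ _).mp (by
      rw [← nabla_eq_smul_covD, nabla_one]; exact hDK κ ν y))
    (fun κ ν hκν y => by
      rw [← plaq_eq_plaqU (1 : PBond P i → 𝔸ˣ) ⟨y, κ, ν, hκν⟩]; exact B12RegularSpaces111Mono.plaq_one _)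
    hCπ hπn (fun μ x X => by simp [dirForm]) b.dir b.src
  rw [Fintype.card_fin] at h
  exact h

end TorusOne

end Literature.MathematicalPhysics.QuantumFieldTheory.Balaban1983to89.B12Eq311RemainderQuadratic
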